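import Mathlib.RingTheory.Ideal.Operations
import Mathlib.Algebra.Module.SpanRank
import Mathlib.RingTheory.LocalRing.MaximalIdeal.Basic
import Mathlib.RingTheory.Noetherian.Basic
import Mathlib.Data.Nat.Prime.Basic
import HarnessLib

/-!
# The order bound at an F-pure point of a purely inseparable `p`-cyclic cover

Card `threshold-window`, mechanism (iii) ("empty wild core"), in its sharp F-pure form.  Let
`(S, 𝔪)` be a Noetherian local ring, `p` a prime, `f ∈ 𝔪 ^ m`, and suppose
`f ^ (p - 1) ∉ 𝔪^[p] := (z ^ p : z ∈ 𝔪)` (by Fedder's criterion this says that the cover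
`S[X]/(X ^ p - f)` is F-pure at the origin).  Then `m ≤ μ(𝔪) = spanFinrank 𝔪`; for a regular
germ `μ(𝔪) = dim S`, so `ord f ≤ dim S < p` as soon as `p > dim S` and the cover has no point
of multiplicity `p`.

The proof is a pigeonhole in the generators and needs no hypothesis on the characteristic.
Write `𝔪 = (x₁, …, x_r)` with `r = spanFinrank 𝔪`
(`Submodule.FG.exists_span_finset_card_eq_spanFinrank`).  The SHARP monomial pigeonhole
`(x₁, …, x_r) ^ (r q + 1) ≤ (x₁ ^ (q + 1), …, x_r ^ (q + 1))`
(`thresholdWindowOrderBound_span_pow_le`) follows by induction on `r` from the sharp binomial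
estimate `(I ⊔ J) ^ (a + b + 1) ≤ I ^ (a + 1) ⊔ J ^ (b + 1)`
(`thresholdWindowOrderBound_sup_pow_le`; Mathlib's `Ideal.sup_pow_add_le_pow_sup_pow` is the
version with exponent `a + b`, one short of what is needed here).  If `m ≥ r + 1` then, as
`p ≥ 2`, `f ^ (p - 1) ∈ 𝔪 ^ (m (p - 1)) ≤ 𝔪 ^ (r (p - 1) + 1) ≤ (x₁ ^ p, …, x_r ^ p) ≤ 𝔪^[p]`,
contradicting the hypothesis.
-/

-- single-problem summit: the doubled namespace component is forced
set_option linter.dupNamespace false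

noncomputable section

namespace Summit.ResolutionOfSingularities.ResolutionOfSingularities.Theorems.FRationalResolution

/-- Sharp binomial estimate for ideals: `(I ⊔ J) ^ (a + b + 1) ≤ I ^ (a + 1) ⊔ J ^ (b + 1)`
(each term `I ^ i * J ^ (a + b + 1 - i)` of the binomial expansion has `i ≥ a + 1` or
`a + b + 1 - i ≥ b + 1`). -/
theorem thresholdWindowOrderBound_sup_pow_le {R : Type*} [CommSemiring R] {I J : Ideal R}
    (a b : ℕ) : (I ⊔ J) ^ (a + b + 1) ≤ I ^ (a + 1) ⊔ J ^ (b + 1) := by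
  rw [← Ideal.add_eq_sup, ← Ideal.add_eq_sup, add_pow, Ideal.sum_eq_sup]
  refine Finset.sup_le fun i _ => ?_
  by_cases hi : a + 1 ≤ i
  · exact Ideal.mul_le_right.trans (Ideal.mul_le_right.trans
      ((Ideal.pow_le_pow_right hi).trans le_sup_left))
  · refine Ideal.mul_le_right.trans (Ideal.mul_le_left.trans
      ((Ideal.pow_le_pow_right ?_).trans le_sup_right))
    omega

/-- Sharp monomial pigeonhole: for a finite set `s` of ring elements,
`(z : z ∈ s) ^ (#s * q + 1) ≤ (z ^ (q + 1) : z ∈ s)` — a monomial of degree `#s * q + 1` in the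
elements of `s` contains some element to a power `≥ q + 1`.  By induction on `s` through
`thresholdWindowOrderBound_sup_pow_le`. -/
theorem thresholdWindowOrderBound_span_pow_le {R : Type*} [CommSemiring R] (q : ℕ)
    (s : Finset R) :
    Ideal.span (s : Set R) ^ (s.card * q + 1) ≤
      Ideal.span ((fun z : R => z ^ (q + 1)) '' (s : Set R)) := by
  classical
  induction s using Finset.induction_on with
  | empty =>
    rw [Finset.coe_empty, Set.image_empty, Ideal.span_empty, Finset.card_empty, zero_mul,
      zero_add, pow_one]
  | insert a s ha ih =>
    rw [Finset.coe_insert, Set.image_insert_eq, Ideal.span_insert, Ideal.span_insert,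
      Finset.card_insert_of_notMem ha, show (s.card + 1) * q + 1 = q + s.card * q + 1 by ring]
    exact (thresholdWindowOrderBound_sup_pow_le q (s.card * q)).trans
      (sup_le_sup (Ideal.span_singleton_pow a (q + 1)).le ih)

/-- **Order bound at an F-pure point** (card `threshold-window`, item (iii)): in a Noetherian
local ring `(S, 𝔪)`, if `f ∈ 𝔪 ^ m` and `f ^ (p - 1) ∉ (z ^ p : z ∈ 𝔪)` for a prime `p`, then
`m ≤ spanFinrank 𝔪`.  Indeed, with `𝔪 = (x₁, …, x_r)`, `r = spanFinrank 𝔪`, and `m ≥ r + 1`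
we would get `f ^ (p - 1) ∈ 𝔪 ^ (m (p - 1)) ≤ 𝔪 ^ (r (p - 1) + 1) ≤ (x₁ ^ p, …, x_r ^ p)`
by the sharp pigeonhole `thresholdWindowOrderBound_span_pow_le`. -/
theorem thresholdWindowOrderBound (p : ℕ) (hp : p.Prime) {S : Type} [CommRing S]
    [IsLocalRing S] [IsNoetherianRing S] (f : S) (m : ℕ)
    (hf : f ∈ IsLocalRing.maximalIdeal S ^ m)
    (hpure : f ^ (p - 1) ∉
      Ideal.span ((fun z : S => z ^ p) '' (IsLocalRing.maximalIdeal S : Set S))) :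
    m ≤ (IsLocalRing.maximalIdeal S).spanFinrank := by
  obtain ⟨s, hcard, hspan⟩ := Submodule.FG.exists_span_finset_card_eq_spanFinrank
    (IsNoetherian.noetherian (IsLocalRing.maximalIdeal S))
  have hspan' : Ideal.span (s : Set S) = IsLocalRing.maximalIdeal S := hspan
  by_contra hlt
  refine hpure ?_
  have hp1 : p - 1 + 1 = p := Nat.sub_add_cancel hp.one_lt.le
  -- exponent bookkeeping: `r (p - 1) + 1 ≤ m (p - 1)` since `m ≥ r + 1` and `p ≥ 2`
  have hexp : s.card * (p - 1) + 1 ≤ m * (p - 1) := by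
    have h2 : 2 ≤ p := hp.two_le
    have hm : s.card + 1 ≤ m := by omega
    calc s.card * (p - 1) + 1 ≤ s.card * (p - 1) + (p - 1) := by omega
      _ = (s.card + 1) * (p - 1) := by ring
      _ ≤ m * (p - 1) := Nat.mul_le_mul_right _ hm
  -- `f ^ (p - 1) ∈ 𝔪 ^ (m (p - 1)) ≤ 𝔪 ^ (r (p - 1) + 1)`
  have h1 : f ^ (p - 1) ∈ IsLocalRing.maximalIdeal S ^ (s.card * (p - 1) + 1) := by
    refine Ideal.pow_le_pow_right hexp ?_
    rw [pow_mul]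
    exact Ideal.pow_mem_pow hf _
  -- the sharp pigeonhole `𝔪 ^ (r (p - 1) + 1) ≤ (x₁ ^ p, …, x_r ^ p)`
  have h3 : IsLocalRing.maximalIdeal S ^ (s.card * (p - 1) + 1) ≤
      Ideal.span ((fun z : S => z ^ p) '' (s : Set S)) := by
    have h := thresholdWindowOrderBound_span_pow_le (p - 1) s
    rwa [hspan', hp1] at h
  -- `(x₁ ^ p, …, x_r ^ p) ≤ (z ^ p : z ∈ 𝔪)`
  have hsub : (s : Set S) ⊆ (IsLocalRing.maximalIdeal S : Set S) := by
    rw [← hspan']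
    exact Ideal.subset_span
  exact Ideal.span_mono (Set.image_mono hsub) (h3 h1)

end Summit.ResolutionOfSingularities.ResolutionOfSingularities.Theorems.FRationalResolution
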